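/-
Copyright (c) 2026. All rights reserved.
Released under Apache 2.0 license as described in the file LICENSE.
Authors: abc-iut cell — seat abc-iut-w6-d031 (gen 2; block C / W6, row «COR27f-MODEL», L4 RULING #7m),
over abc-iut-L4-t12's `HolomorphicEllipticCuspidalization.lean` and the `ComplexTorus` library.
-/
import Literature.AnabelianGeometry.AbsoluteAnabelian.HolomorphicEllipticCuspidalizationTorsionHolds
import Literature.AnabelianGeometry.AbsoluteAnabelian.HolomorphicEllipticCuspidalizationTransportProofs
import HarnessLib

/-!
# [AbsTopIII] Cor 2.7 (f) «functoriality w.r.t. finite étale morphisms» AT THE MODEL FAMILY, II: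
# the isomorphism case WITH the group laws of (c) (MODEL-LEVEL)

S. Mochizuki, *Topics in absolute anabelian geometry III*, §2, Corollary 2.7, kurims p. 60 l. 15–16
(J. Math. Sci. Univ. Tokyo **22** (2015) p. 1017; bib key `MochizukiAbsTopIII2015`), the closing sentence
of the statement, read on the page: «Finally, the asserted “functoriality” is with respect to finite étale
morphisms of Aut-holomorphic orbispaces arising from hyperbolic orbicurves over ℂ.»  This item (f) is
UNTYPED in the statement of record `ArchimedeanReconstruction.lean` (p408225); the cell's Cor 2.7 table
(abc-iut-L4-t8, 2026-08-26) records only its ISOMORPHISM case for the torsion points, the sub-node (c).5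
`HolomorphicEllipticCuspidalization.CuspidalTorsionPointsTransport` (PROVED, p416164:
`cuspidalTorsionPointsTransport_holds` — a biholomorphism carries cuspidal torsion points onto cuspidal
torsion points).

PROOF-ONLY companion (kind = proof: no definition, no named fact, nothing restated; label
**MODEL-LEVEL**) of `HolomorphicEllipticCuspidalization.lean` (p414370), part II of two (part I,
`HolomorphicEllipticCuspidalizationFunctorialityIsogenies.lean`: isogenies, the coverings
`[N] : 𝕌_N → 𝔼` and their deck translations pull back / push forward the cuspidal torsion points).  At
the cell's MODEL FAMILY of «the Aut-holomorphic space associated to a once-punctured elliptic curve» — the punctured complex tori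
`𝔼_Φ = T_Φ ∖ {0}`, `T_Φ = ℂ/Φ(ℤ^ι)` (`puncturedTorus Φ`), to which EVERY typed punctured elliptic curve
is biholomorphic ((c).4 `puncturedEllipticCurveModel_holds`) — it proves that a biholomorphism of
model punctured tori (by (i) below, the GENERAL finite étale morphism of once-punctured elliptic curves)
carries the outputs of the algorithm of Cor 2.7 (the cuspidal torsion points of (b) with their group
structure, and the group law of (c) on the one-point compactification `T`) to one another:

* **the isomorphism case, WITH THE GROUP LAWS of (c)** — a biholomorphism `γ : 𝔼_Φ ⥲ 𝔼_{Φ'}`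
  extended by `0 ↦ 0` is continuous (`γ` is proper) and holomorphic on `T_Φ` (Riemann's removable
  singularity theorem, the tree's `RiemannSurface.mdifferentiableAt_of_continuousAt`), hence ADDITIVE
  (Lange–Birkenhake Prop. 1.1.6, the tree's `ComplexTorus.map_add_of_mdifferentiable`):
  `continuous_extend_zero`, `mdifferentiable_extend_zero`, `extend_zero_add`, and
  **`existsUnique_continuousAddEquiv_extends`** — `γ` extends UNIQUELY to an isomorphism of topological
  groups `T_Φ ≃ₜ+ T_{Φ'}` of the one-point compactifications, i.e. it is compatible with «the group
  structure on (the one-point compactification of) `E^top`» of (c) ((c).6 `OnePointPuncturedTorus`: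
  `onePointCongr_eq_extend`); corollaries `coe_map_add`, `coe_map_neg`, `addOrderOf_map_eq` (the
  Gal-induced group structure on the torsion points of (b) is respected), `isOfFinAddOrder_map_iff`.

WHAT A FULL (f) WOULD NEED (not attempted here, by the L4 lead's ruling #7m): (i) for the `𝔼`-data, a
finite étale morphism between ONCE-punctured elliptic curves has degree `1` — the Euler characteristic
`χ = 2 − 2g − n = −1` of a once-punctured elliptic curve is multiplicative in finite étale covers
(Riemann–Hurwitz) — so it is an isomorphism and (f) for the torsion points / group laws IS the
isomorphism case (this file) + (c).5 (equivalently: every finite étale map of once-punctured elliptic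
curves is a translate of an isogeny after compactification, with trivial kernel); this classification is
not in the tree; (ii) for elliptically admissible Aut-holomorphic ORBISPACES `X' → X`, the common semi-elliptic
hyperbolic core `ℍ` and its unique double cover `𝔼` (Cor 2.7 (a) = Cor 2.4 (c), FACT-policy named facts
`HyperbolicCoreOrbispace` / `DeckGroupInAutIdComponent`) make the local linear holomorphic structures on
`X'^top`, `X^top` pull-backs of the one on `𝔼^top` along local homeomorphisms — an untyped junction (no
orbifold-`π₁` ↔ Fuchsian dictionary in the tree), exactly as for item (a).

HONEST FRAMING: model-level ≠ node-level; OUR proofs about OUR typing of a refereed pre-IUT statement;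
typed ≠ endorsed; nothing here bears on the disputed [IUTchIII] Cor. 3.12; no side taken.
-/


noncomputable section

namespace Literature.AnabelianGeometry.AbsoluteAnabelian

namespace HolomorphicEllipticCuspidalization

open _root_.TopologicalSpace _root_.Topology _root_.Set _root_.Function _root_.Filter
open scoped _root_.Manifold _root_.ContDiff
open Literature.Geometry.Kaehler (ComplexTorus)

/-! ### (f) in the isomorphism case, with the group laws of (c): biholomorphisms of punctured tori are
restrictions of isomorphisms of topological groups of the compactifications -/

section Iso

variable {ι ι' : Type} [Fintype ι] [Fintype ι'] {Φ : (ι → ℝ) ≃L[ℝ] ℂ} {Φ' : (ι' → ℝ) ≃L[ℝ] ℂ}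
  (γ : ↥(puncturedTorus Φ) ≃ₜ ↥(puncturedTorus Φ'))

/-- The extension `Γ` of `γ` by `0 ↦ 0` (written `Function.extend val (val ∘ γ) 0`; no definition is
introduced) agrees with `γ` on `𝔼`. [cite: MochizukiAbsTopIII2015, Corollary 2.7 (f) p.60] -/
theorem extend_zero_apply_coe (x : ↥(puncturedTorus Φ)) :
    Function.extend (Subtype.val : ↥(puncturedTorus Φ) → ComplexTorus Φ)
        (fun x => ((γ x : ↥(puncturedTorus Φ')) : ComplexTorus Φ')) (fun _ => 0) (x : ComplexTorus Φ) =
      ((γ x : ↥(puncturedTorus Φ')) : ComplexTorus Φ') :=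
  Subtype.val_injective.extend_apply _ _ x

/-- The extension sends the puncture to the puncture: `Γ 0 = 0`. [cite: MochizukiAbsTopIII2015, Corollary 2.7 (f) p.60] -/
theorem extend_zero_apply_zero :
    Function.extend (Subtype.val : ↥(puncturedTorus Φ) → ComplexTorus Φ)
        (fun x => ((γ x : ↥(puncturedTorus Φ')) : ComplexTorus Φ')) (fun _ => 0) 0 = 0 := by
  refine Function.extend_apply' _ _ _ ?_
  rintro ⟨x, hx⟩
  exact ((mem_puncturedTorus_iff Φ _).1 x.2) hx

/-- At a non-zero point `t`, `Γ t = γ ⟨t, _⟩`. [cite: MochizukiAbsTopIII2015, Corollary 2.7 (f) p.60] -/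
theorem extend_zero_apply_of_ne_zero {t : ComplexTorus Φ} (ht : t ≠ 0) :
    Function.extend (Subtype.val : ↥(puncturedTorus Φ) → ComplexTorus Φ)
        (fun x => ((γ x : ↥(puncturedTorus Φ')) : ComplexTorus Φ')) (fun _ => 0) t =
      ((γ ⟨t, (mem_puncturedTorus_iff Φ t).2 ht⟩ : ↥(puncturedTorus Φ')) : ComplexTorus Φ') :=
  extend_zero_apply_coe γ ⟨t, (mem_puncturedTorus_iff Φ t).2 ht⟩

/-- `Γ t = 0 ↔ t = 0`. [cite: MochizukiAbsTopIII2015, Corollary 2.7 (f) p.60] -/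
theorem extend_zero_eq_zero_iff (t : ComplexTorus Φ) :
    Function.extend (Subtype.val : ↥(puncturedTorus Φ) → ComplexTorus Φ)
        (fun x => ((γ x : ↥(puncturedTorus Φ')) : ComplexTorus Φ')) (fun _ => 0) t = 0 ↔ t = 0 := by
  refine ⟨fun h => ?_, fun h => h ▸ extend_zero_apply_zero γ⟩
  by_contra ht
  rw [extend_zero_apply_of_ne_zero γ ht] at h
  exact ((mem_puncturedTorus_iff Φ' _).1 (γ _).2) h

/-- **`Γ` is continuous**: on `𝔼` it is `γ`; at `0` it tends to `0` because `γ` is proper and `T` is the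
one-point compactification of `𝔼` at `0` («(the one-point compactification of) `E^top`»).
[cite: MochizukiAbsTopIII2015, Corollary 2.7 (f) p.60] -/
theorem continuous_extend_zero :
    Continuous (Function.extend (Subtype.val : ↥(puncturedTorus Φ) → ComplexTorus Φ)
        (fun x => ((γ x : ↥(puncturedTorus Φ')) : ComplexTorus Φ')) (fun _ => 0)) := by
  set Γ := Function.extend (Subtype.val : ↥(puncturedTorus Φ) → ComplexTorus Φ)
        (fun x => ((γ x : ↥(puncturedTorus Φ')) : ComplexTorus Φ')) (fun _ => 0) with hΓ
  have hval : IsOpenEmbedding (Subtype.val : ↥(puncturedTorus Φ) → ComplexTorus Φ) :=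
    (puncturedTorus Φ).isOpenEmbedding'
  rw [continuous_iff_continuousAt]
  intro t
  by_cases ht : t = 0
  · subst ht
    have h0 : Γ 0 = 0 := extend_zero_apply_zero γ
    rw [ContinuousAt, h0, (nhds_basis_opens (0 : ComplexTorus Φ')).tendsto_right_iff]
    rintro W ⟨h0W, hWo⟩
    -- `Wᶜ` is compact, contained in `𝔼'`; its preimage under the proper `γ` is compact in `𝔼`
    have hC : IsCompact Wᶜ := hWo.isClosed_compl.isCompact
    have hCsub : Wᶜ ⊆ Set.range (Subtype.val : ↥(puncturedTorus Φ') → ComplexTorus Φ') := by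
      intro c hc
      refine ⟨⟨c, (mem_puncturedTorus_iff Φ' c).2 ?_⟩, rfl⟩
      rintro rfl
      exact hc h0W
    have hK' : IsCompact ((Subtype.val : ↥(puncturedTorus Φ') → ComplexTorus Φ') ⁻¹' Wᶜ) :=
      Topology.IsInducing.subtypeVal.isCompact_preimage' hC hCsub
    have hK : IsCompact (γ ⁻¹' ((Subtype.val : ↥(puncturedTorus Φ') → ComplexTorus Φ') ⁻¹' Wᶜ)) := by
      rw [← γ.image_symm]
      exact hK'.image γ.symm.continuous
    have hK₂ : IsCompact ((Subtype.val : ↥(puncturedTorus Φ) → ComplexTorus Φ) ''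
        (γ ⁻¹' ((Subtype.val : ↥(puncturedTorus Φ') → ComplexTorus Φ') ⁻¹' Wᶜ))) :=
      hK.image continuous_subtype_val
    have h0K₂ : (0 : ComplexTorus Φ) ∉ (Subtype.val : ↥(puncturedTorus Φ) → ComplexTorus Φ) ''
        (γ ⁻¹' ((Subtype.val : ↥(puncturedTorus Φ') → ComplexTorus Φ') ⁻¹' Wᶜ)) := by
      rintro ⟨a, -, ha⟩
      exact ((mem_puncturedTorus_iff Φ _).1 a.2) ha
    filter_upwards [hK₂.isClosed.compl_mem_nhds h0K₂] with s hs
    by_cases hs0 : s = 0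
    · rw [hs0, h0]
      exact h0W
    · rw [show Γ s = _ from extend_zero_apply_of_ne_zero γ hs0]
      by_contra hW
      exact hs ⟨⟨s, (mem_puncturedTorus_iff Φ s).2 hs0⟩, hW, rfl⟩
  · have htval : t = ((⟨t, (mem_puncturedTorus_iff Φ t).2 ht⟩ : ↥(puncturedTorus Φ)) : ComplexTorus Φ) :=
      rfl
    rw [htval]
    refine (hval.continuousAt_iff).1 ?_
    have hcomp : Γ ∘ (Subtype.val : ↥(puncturedTorus Φ) → ComplexTorus Φ) =
        fun x => ((γ x : ↥(puncturedTorus Φ')) : ComplexTorus Φ') :=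
      funext fun x => extend_zero_apply_coe γ x
    rw [hcomp]
    exact (continuous_subtype_val.comp γ.continuous).continuousAt

/-- **`Γ` is holomorphic on all of `T_Φ`** when `γ` is: off `0` it is `γ` read in `T_{Φ'}`; at `0` it is
continuous, hence holomorphic by Riemann's removable singularity theorem (the tree's
`RiemannSurface.mdifferentiableAt_of_continuousAt`). [cite: MochizukiAbsTopIII2015, Corollary 2.7 (f) p.60] -/
theorem mdifferentiable_extend_zero (hγ : MDifferentiable 𝓘(ℂ, ℂ) 𝓘(ℂ, ℂ) γ) :
    MDifferentiable 𝓘(ℂ, ℂ) 𝓘(ℂ, ℂ)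
      (Function.extend (Subtype.val : ↥(puncturedTorus Φ) → ComplexTorus Φ)
        (fun x => ((γ x : ↥(puncturedTorus Φ')) : ComplexTorus Φ')) (fun _ => 0)) := by
  set Γ := Function.extend (Subtype.val : ↥(puncturedTorus Φ) → ComplexTorus Φ)
        (fun x => ((γ x : ↥(puncturedTorus Φ')) : ComplexTorus Φ')) (fun _ => 0) with hΓ
  have hoff : ∀ x : ↥(puncturedTorus Φ), MDifferentiableAt 𝓘(ℂ, ℂ) 𝓘(ℂ, ℂ) Γ (x : ComplexTorus Φ) := by
    intro x
    rw [← mdifferentiableAt_subtype_iff (U := puncturedTorus Φ) (f := Γ)]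
    have hcomp : (fun x : ↥(puncturedTorus Φ) => Γ x) =
        Subtype.val ∘ (γ : ↥(puncturedTorus Φ) → ↥(puncturedTorus Φ')) :=
      funext fun x => extend_zero_apply_coe γ x
    rw [hcomp, mdifferentiableAt_subtypeVal_comp_iff]
    exact hγ x
  intro t
  by_cases ht : t = 0
  · subst ht
    refine Literature.Geometry.Kaehler.RiemannSurface.mdifferentiableAt_of_continuousAt
      (continuous_extend_zero γ).continuousAt ?_
    filter_upwards [self_mem_nhdsWithin] with s hs
    exact hoff ⟨s, (mem_puncturedTorus_iff Φ s).2 hs⟩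
  · exact hoff ⟨t, (mem_puncturedTorus_iff Φ t).2 ht⟩

/-- **`Γ` is ADDITIVE**: a holomorphic map of complex tori fixing `0` is a homomorphism (Lange–Birkenhake
Prop. 1.1.6, the tree's `ComplexTorus.map_add_of_mdifferentiable`). [cite: MochizukiAbsTopIII2015, Corollary 2.7 (f) p.60] -/
theorem extend_zero_add (hγ : MDifferentiable 𝓘(ℂ, ℂ) 𝓘(ℂ, ℂ) γ) (x y : ComplexTorus Φ) :
    Function.extend (Subtype.val : ↥(puncturedTorus Φ) → ComplexTorus Φ)
        (fun x => ((γ x : ↥(puncturedTorus Φ')) : ComplexTorus Φ')) (fun _ => 0) (x + y) =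
      Function.extend (Subtype.val : ↥(puncturedTorus Φ) → ComplexTorus Φ)
          (fun x => ((γ x : ↥(puncturedTorus Φ')) : ComplexTorus Φ')) (fun _ => 0) x +
        Function.extend (Subtype.val : ↥(puncturedTorus Φ) → ComplexTorus Φ)
          (fun x => ((γ x : ↥(puncturedTorus Φ')) : ComplexTorus Φ')) (fun _ => 0) y :=
  Literature.Geometry.Kaehler.ComplexTorus.map_add_of_mdifferentiable (mdifferentiable_extend_zero γ hγ)
    (extend_zero_apply_zero γ) x y

/-- The extensions of `γ` and `γ⁻¹` are mutually inverse. [cite: MochizukiAbsTopIII2015, Corollary 2.7 (f) p.60] -/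
theorem extend_zero_symm_apply_extend_zero (t : ComplexTorus Φ) :
    Function.extend (Subtype.val : ↥(puncturedTorus Φ') → ComplexTorus Φ')
        (fun x => ((γ.symm x : ↥(puncturedTorus Φ)) : ComplexTorus Φ)) (fun _ => 0)
      (Function.extend (Subtype.val : ↥(puncturedTorus Φ) → ComplexTorus Φ)
        (fun x => ((γ x : ↥(puncturedTorus Φ')) : ComplexTorus Φ')) (fun _ => 0) t) = t := by
  by_cases ht : t = 0
  · subst ht
    rw [extend_zero_apply_zero γ, extend_zero_apply_zero γ.symm]
  · rw [extend_zero_apply_of_ne_zero γ ht]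
    rw [extend_zero_apply_coe γ.symm (γ ⟨t, (mem_puncturedTorus_iff Φ t).2 ht⟩), γ.symm_apply_apply]

/-- **(f) at the model in the isomorphism case, with the group laws of (c)** (MODEL-LEVEL): a
biholomorphism `γ : 𝔼_Φ ⥲ 𝔼_{Φ'}` of punctured complex tori extends UNIQUELY to an isomorphism of
TOPOLOGICAL GROUPS `Γ : T_Φ ≃ₜ+ T_{Φ'}` of «(the one-point compactification of) `E^top`» with «the group
structure … that arises from the elliptic curve determined by `E`» — so the group laws of Cor 2.7 (c),
the unique topological group structures extending the Gal-induced laws on the torsion points of (b)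
(`torsionPoints_groupLaw_unique`), are carried to one another by `γ`.
[cite: MochizukiAbsTopIII2015, Corollary 2.7 (f) p.60] -/
theorem existsUnique_continuousAddEquiv_extends (hγ : MDifferentiable 𝓘(ℂ, ℂ) 𝓘(ℂ, ℂ) γ) :
    ∃! Γ : ComplexTorus Φ ≃ₜ+ ComplexTorus Φ',
      ∀ x : ↥(puncturedTorus Φ), Γ (x : ComplexTorus Φ) = ((γ x : ↥(puncturedTorus Φ')) : ComplexTorus Φ') := by
  let Γ₀ : ComplexTorus Φ ≃ₜ+ ComplexTorus Φ' :=
    { toFun := Function.extend (Subtype.val : ↥(puncturedTorus Φ) → ComplexTorus Φ)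
        (fun x => ((γ x : ↥(puncturedTorus Φ')) : ComplexTorus Φ')) (fun _ => 0)
      invFun := Function.extend (Subtype.val : ↥(puncturedTorus Φ') → ComplexTorus Φ')
        (fun x => ((γ.symm x : ↥(puncturedTorus Φ)) : ComplexTorus Φ)) (fun _ => 0)
      left_inv := fun t => extend_zero_symm_apply_extend_zero γ t
      right_inv := fun t => by
        have h := extend_zero_symm_apply_extend_zero γ.symm t
        rwa [γ.symm_symm] at h
      map_add' := extend_zero_add γ hγ
      continuous_toFun := continuous_extend_zero γ
      continuous_invFun := continuous_extend_zero γ.symm }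
  refine ⟨Γ₀, fun x => extend_zero_apply_coe γ x, fun Γ₁ hΓ₁ => ?_⟩
  ext t
  by_cases ht : t = 0
  · subst ht
    rw [map_zero, map_zero]
  · rw [show t = ((⟨t, (mem_puncturedTorus_iff Φ t).2 ht⟩ : ↥(puncturedTorus Φ)) : ComplexTorus Φ) from rfl,
      hΓ₁]
    exact (extend_zero_apply_coe γ _).symm

/-- **`γ` is compatible with the group laws** (read without the extension): for cuspidal torsion points —
indeed for ALL points — `x, y ∈ 𝔼_Φ` with `x + y ≠ 0` in `T_Φ`, `γ(x + y) = γ x + γ y` in `T_{Φ'}`.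
[cite: MochizukiAbsTopIII2015, Corollary 2.7 (f) p.60] -/
theorem coe_map_add (hγ : MDifferentiable 𝓘(ℂ, ℂ) 𝓘(ℂ, ℂ) γ) (x y : ↥(puncturedTorus Φ))
    (hxy : (x : ComplexTorus Φ) + (y : ComplexTorus Φ) ≠ 0) :
    ((γ ⟨(x : ComplexTorus Φ) + y, (mem_puncturedTorus_iff Φ _).2 hxy⟩ : ↥(puncturedTorus Φ')) :
        ComplexTorus Φ') =
      ((γ x : ↥(puncturedTorus Φ')) : ComplexTorus Φ') + (γ y : ↥(puncturedTorus Φ')) := by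
  rw [← extend_zero_apply_coe γ x, ← extend_zero_apply_coe γ y, ← extend_zero_add γ hγ,
    ← extend_zero_apply_of_ne_zero γ hxy]

/-- `γ` commutes with negation: `γ(−x) = −γ(x)` in `T_{Φ'}`. [cite: MochizukiAbsTopIII2015, Corollary 2.7 (f) p.60] -/
theorem coe_map_neg (hγ : MDifferentiable 𝓘(ℂ, ℂ) 𝓘(ℂ, ℂ) γ) (x : ↥(puncturedTorus Φ)) :
    ((γ ⟨-(x : ComplexTorus Φ), (mem_puncturedTorus_iff Φ _).2
        (neg_ne_zero.2 ((mem_puncturedTorus_iff Φ _).1 x.2))⟩ : ↥(puncturedTorus Φ')) : ComplexTorus Φ') =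
      -((γ x : ↥(puncturedTorus Φ')) : ComplexTorus Φ') := by
  obtain ⟨Γ, hΓ, -⟩ := existsUnique_continuousAddEquiv_extends γ hγ
  rw [← hΓ x, ← map_neg, ← hΓ]

/-- **The group structure on the torsion points is respected**: `γ` preserves additive orders in the
compactifications (in particular torsion ↔ torsion, consistent with (c).5). [cite: MochizukiAbsTopIII2015, Corollary 2.7 (f) p.60] -/
theorem addOrderOf_map_eq (hγ : MDifferentiable 𝓘(ℂ, ℂ) 𝓘(ℂ, ℂ) γ) (x : ↥(puncturedTorus Φ)) :
    addOrderOf ((γ x : ↥(puncturedTorus Φ')) : ComplexTorus Φ') = addOrderOf (x : ComplexTorus Φ) := by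
  obtain ⟨Γ, hΓ, -⟩ := existsUnique_continuousAddEquiv_extends γ hγ
  rw [← hΓ x]
  exact addOrderOf_injective Γ.toAddMonoidHom Γ.injective _

/-- `γ x` is a torsion point of `T_{Φ'}` iff `x` is a torsion point of `T_Φ` (the content of (c).5 at the
model, re-derived from the group isomorphism). [cite: MochizukiAbsTopIII2015, Corollary 2.7 (f) p.60] -/
theorem isOfFinAddOrder_map_iff (hγ : MDifferentiable 𝓘(ℂ, ℂ) 𝓘(ℂ, ℂ) γ) (x : ↥(puncturedTorus Φ)) :
    IsOfFinAddOrder ((γ x : ↥(puncturedTorus Φ')) : ComplexTorus Φ') ↔ IsOfFinAddOrder (x : ComplexTorus Φ) := by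
  rw [← addOrderOf_pos_iff, ← addOrderOf_pos_iff, addOrderOf_map_eq γ hγ x]

/-- Consistency with (c).5 (`cuspidalTorsionPointsTransport_holds`, p416164) and (b).eq: membership of
`γ x` in the cuspidal torsion points of `𝔼_{Φ'}` is membership of `x` in those of `𝔼_Φ`, obtained here
from the group isomorphism. [cite: MochizukiAbsTopIII2015, Corollary 2.7 (f) p.60] -/
theorem mem_cuspidalTorsionPoints_map_iff (hγ : MDifferentiable 𝓘(ℂ, ℂ) 𝓘(ℂ, ℂ) γ) (x : ↥(puncturedTorus Φ)) :
    γ x ∈ cuspidalTorsionPoints ↥(puncturedTorus Φ') ↔ x ∈ cuspidalTorsionPoints ↥(puncturedTorus Φ) := by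
  rw [mem_cuspidalTorsionPoints_iff, mem_cuspidalTorsionPoints_iff]
  exact isOfFinAddOrder_map_iff γ hγ x

/-- **Junction with (c).6 `OnePointPuncturedTorus`**: under ANY identifications `e : OnePoint 𝔼_Φ ≃ₜ T_Φ`,
`e' : OnePoint 𝔼_{Φ'} ≃ₜ T_{Φ'}` of the one-point compactifications with the compact tori sending `∞ ↦ 0`
and extending the inclusions (they exist: `onePointPuncturedTorus_holds`), Mathlib's functorial extension
`γ.onePointCongr : OnePoint 𝔼_Φ ≃ₜ OnePoint 𝔼_{Φ'}` IS the additive extension `Γ` — so the group laws of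
(c) transported to the one-point compactifications are respected by `γ.onePointCongr`.
[cite: MochizukiAbsTopIII2015, Corollary 2.7 (f) p.60] -/
theorem onePointCongr_eq_extend (e : OnePoint ↥(puncturedTorus Φ) ≃ₜ ComplexTorus Φ)
    (he : e OnePoint.infty = 0) (he' : ∀ x : ↥(puncturedTorus Φ), e x = (x : ComplexTorus Φ))
    (e' : OnePoint ↥(puncturedTorus Φ') ≃ₜ ComplexTorus Φ') (he'₁ : e' OnePoint.infty = 0)
    (he'₂ : ∀ x : ↥(puncturedTorus Φ'), e' x = (x : ComplexTorus Φ')) (p : OnePoint ↥(puncturedTorus Φ)) :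
    e' (γ.onePointCongr p) =
      Function.extend (Subtype.val : ↥(puncturedTorus Φ) → ComplexTorus Φ)
        (fun x => ((γ x : ↥(puncturedTorus Φ')) : ComplexTorus Φ')) (fun _ => 0) (e p) := by
  induction p using OnePoint.rec with
  | infty =>
    rw [he, extend_zero_apply_zero γ, Homeomorph.onePointCongr_apply, OnePoint.map_infty, he'₁]
  | coe x =>
    rw [he' x, extend_zero_apply_coe γ x, Homeomorph.onePointCongr_apply, OnePoint.map_some, he'₂]

end Iso

end HolomorphicEllipticCuspidalization

end Literature.AnabelianGeometry.AbsoluteAnabelian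

end
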